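import Literature.NumberTheory.Automorphic.GLTwoAdelicTorus
import Literature.NumberTheory.Automorphic.GLnPlacesSplitting
import Literature.NumberTheory.Automorphic.QuaternionAdelicUnitsPlacesSplitting
import HarnessLib

/-!
# The adelic torus `E_𝔸ˣ → GL₂(𝔸_K)` of `γ ∈ GL₂(K)` respects the place decompositions
# `E_𝔸ˣ = E_Sˣ × E^{S,×}` and `GL₂(𝔸_K) = G_S × G^S`
(Gelbart, *Automorphic forms on adele groups* (1975), §10, pp. 153–155: the torus `B_𝔸 = B_𝔸(E)` of the
`GL(2)` trace formula factors as `B_S × B^S` along `G_𝔸 = G_S × G^S`, (10.19))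

Topic `NumberTheory/Automorphic`; two small definitions with bodies (`glTwoLocalTorusMap`, the local
torus `E_vˣ = (K_v ⊗_K E)ˣ →* GL₂(K_v)`, units of `subalgebraToMatrix` over `K_v`; `glTwoDatumTorusMap`,
the adelic torus map `glTwoTorusMap` of `GLTwoAdelicTorus` with target spelled `(AdelicGroupData.gl 2 K).Adelic`,
the type on which `GLn.placesSplitting` lives) and theorems; no named fact, no instance. For
`E = C_{M₂(K)}(γ) ≤ M₂(K)` and the torus map `j : E_𝔸ˣ → GL₂(𝔸_K)`, `r ⊗ e ↦ r • e`:

* `ScalarExtension.subalgebraToMatrix_mapLeft` — naturality of `R ⊗_K E → M_n(R)` in `R`: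
  `(j_R x).map g = j_{R'} ((g ⊗ 1) x)` for a `K`-algebra map `g : R → R'`;
* `adeleSingleHom_mul_algebraMap`, `ScalarExtension.subalgebraToMatrix_localToAdelic` —
  `j_𝔸 (ι_v x) = (j_v x).map ι_v` for the factor inclusion `ι_v : K_v → 𝔸_K`;
* `toLocalAt_glTwoDatumTorusMap` — **`(j u)_v = j_v (u_v)`**;
* `glTwoDatumTorusMap_ofLocal` — **`j (ι_v t) = ι_v (j_v t)`**;
* `glTwoDatumTorusMap_mem_trivialAt`, `glTwoDatumTorusMap_toAdelicPi`, `glTwoDatumTorusMap_awayFromPlaces`,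
  `glTwoDatumTorusMap_placesSplitting`, `placesSplitting_symm_glTwoDatumTorusMap` — **`j` carries the
  splitting `Quat.placesSplitting K E S` of `E_𝔸ˣ` to the splitting `GLn.placesSplitting 2 K S` of
  `GL₂(𝔸_K)`**: `j ∘ splitting_E = splitting_{GL₂} ∘ (j_S × j|_{E^{S,×}})`.

The `GL(2)` twin of `AdelicUnitsPlacesNaturality` (maps `D'_𝔸ˣ → D_𝔸ˣ` induced by algebra maps); with
it, Haar measures on the torus given as products over the places are carried to products, which is
how the measures `db = Π db_v` on `B_𝔸` enter (10.19)–(10.21). Part of the inline (D-0026)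
decomposition of `Literature.NumberTheory.Automorphic.strong_multiplicity_one_quaternionUnits`.

## References

* S. Gelbart, *Automorphic forms on adele groups*, Ann. of Math. Studies 83 (1975), §10,
  pp. 153–155 [Gelbart1975].
* D. Bump, *Automorphic Forms and Representations* (1997), §3.3 (`GL(n, 𝔸) = GL(n, F_S) × GL(n, 𝔸^S)`)
  [Bump1997].
-/

noncomputable section

open NumberField IsDedekindDomain Topology Matrix
open scoped TensorProduct MatrixGroups

namespace Literature.NumberTheory.Automorphic

/-! ### Naturality of `R ⊗_K E → M_n(R)` in `R` -/

section SubalgebraToMatrix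

variable (K : Type*) [Field K] {R : Type*} [CommRing R] [Algebra K R] {R' : Type*} [CommRing R'] [Algebra K R']
  {n : Type*} [Fintype n] [DecidableEq n] (E : Subalgebra K (Matrix n n K))

/-- **Naturality of `subalgebraToMatrix` in the ring of scalars**: for a `K`-algebra map `g : R → R'`,
`(j_R x).map g = j_{R'} ((g ⊗ 1) x)`. [folklore] -/
theorem ScalarExtension.subalgebraToMatrix_mapLeft (g : R →ₐ[K] R') (x : ScalarExtension K R E) :
    (ScalarExtension.subalgebraToMatrix K R E x).map g =
      ScalarExtension.subalgebraToMatrix K R' E (ScalarExtension.mapLeft K E g x) := by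
  have hmap : ∀ M : Matrix n n R, M.map g = g.toRingHom.mapMatrix M := fun M => rfl
  rw [hmap]
  induction x using ScalarExtension.induction_on' K R E with
  | zero => simp only [map_zero]
  | tmul r e =>
    rw [ScalarExtension.subalgebraToMatrix_tmul, ScalarExtension.mapLeft_tmul, ScalarExtension.subalgebraToMatrix_tmul,
      ← hmap]
    ext i j
    simp only [Matrix.map_apply, Matrix.smul_apply, smul_eq_mul, map_mul, AlgHom.commutes]
  | add X Y hX hY => rw [map_add, map_add, hX, hY, map_add, map_add]

end SubalgebraToMatrix

/-! ### The factor inclusion `K_v → 𝔸_K` and the torus -/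

section Single

variable (K : Type) [Field K] [NumberField K] (v : HeightOneSpectrum (𝓞 K))

/-- `ι_v (a · c) = ι_v(a) · c` for `c ∈ K` (diagonally embedded): the factor inclusion is `K`-linear
(`adeleSingleLinear`). [folklore] -/
theorem adeleSingleHom_mul_algebraMap (a : v.adicCompletion K) (c : K) :
    adeleSingleHom K v (a * algebraMap K (v.adicCompletion K) c) =
      adeleSingleHom K v a * algebraMap K (AdeleRing (𝓞 K) K) c := by
  have h := (adeleSingleLinear K v).map_smul c a
  rw [adeleSingleLinear_apply, adeleSingleLinear_apply, Algebra.smul_def, Algebra.smul_def] at h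
  rw [mul_comm, h, mul_comm]

variable {n : Type*} [Fintype n] [DecidableEq n] (E : Subalgebra K (Matrix n n K))

/-- **`j_𝔸 (ι_v x) = (j_v x).map ι_v`**: the torus maps intertwine the factor inclusions
`K_v ⊗ E → 𝔸_K ⊗ E` (`Quat.localToAdelic`) and `M_n(K_v) → M_n(𝔸_K)` (entrywise `adeleSingleHom`).
[folklore] -/
theorem ScalarExtension.subalgebraToMatrix_localToAdelic (x : ScalarExtension K (v.adicCompletion K) E) :
    ScalarExtension.subalgebraToMatrix K (AdeleRing (𝓞 K) K) E (Quat.localToAdelic K E v x) =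
      (ScalarExtension.subalgebraToMatrix K (v.adicCompletion K) E x).map (adeleSingleHom K v) := by
  induction x using ScalarExtension.induction_on' K (v.adicCompletion K) E with
  | zero =>
    rw [map_zero, map_zero, map_zero]
    exact (Matrix.map_zero _ (map_zero _)).symm
  | tmul a e =>
    change ScalarExtension.subalgebraToMatrix K (AdeleRing (𝓞 K) K) E
      (ScalarExtension.ofTensor K _ E (adeleSingleHom K v a ⊗ₜ[K] e)) = _
    rw [ScalarExtension.subalgebraToMatrix_tmul, ScalarExtension.subalgebraToMatrix_tmul]
    ext i j
    simp only [Matrix.map_apply, Matrix.smul_apply, smul_eq_mul]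
    rw [adeleSingleHom_mul_algebraMap]
  | add X Y hX hY =>
    rw [map_add, map_add, hX, hY, map_add]
    ext i j
    simp only [Matrix.add_apply, Matrix.map_apply, map_add]

end Single

/-! ### The local tori and the keyed adelic torus map -/

section Torus

variable (K : Type) [Field K] [NumberField K] (γ : GL (Fin 2) K)

/-- `E = C_{M₂(K)}(γ)`. -/
local notation "Eγ" => Subalgebra.centralizer K ({(γ : Matrix (Fin 2) (Fin 2) K)} :
  Set (Matrix (Fin 2) (Fin 2) K))

/-- **The local torus `E_vˣ = (K_v ⊗_K E)ˣ →* GL₂(K_v)`** of `γ ∈ GL₂(K)`, `E = C_{M₂(K)}(γ)`: the units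
of `subalgebraToMatrix` over `K_v` (`r ⊗ e ↦ r • e`) — Gelbart's `B_v ≤ G_v` (p. 155). [cite: Gelbart1975, p. 155] -/
def glTwoLocalTorusMap (v : HeightOneSpectrum (𝓞 K)) : completionUnits Eγ v →* GL (Fin 2) (v.adicCompletion K) :=
  Units.map (ScalarExtension.subalgebraToMatrix K (v.adicCompletion K) Eγ).toRingHom.toMonoidHom

/-- **The adelic torus map with target `(AdelicGroupData.gl 2 K).Adelic`** (`= glTwoTorusMap K γ`; this
spelling keeps products inside the type of `GLn.placesSplitting`, cf. `GLn.toAdelic`). [folklore] -/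
def glTwoDatumTorusMap : adelicUnits K Eγ →* (AdelicGroupData.gl 2 K).Adelic :=
  glTwoTorusMap K γ

variable {K γ}

/-- On matrices `glTwoLocalTorusMap v t = subalgebraToMatrix t` (definitional). [folklore] -/
theorem coe_glTwoLocalTorusMap {v : HeightOneSpectrum (𝓞 K)} (t : completionUnits Eγ v) :
    ((glTwoLocalTorusMap K γ v t : GL (Fin 2) (v.adicCompletion K)) : Matrix (Fin 2) (Fin 2) (v.adicCompletion K)) =
      ScalarExtension.subalgebraToMatrix K (v.adicCompletion K) Eγ
        ((t : completionUnits Eγ v) : ScalarExtension K (v.adicCompletion K) Eγ) := rfl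

/-- `glTwoDatumTorusMap = glTwoTorusMap` (definitional). [folklore] -/
theorem glTwoDatumTorusMap_apply (u : adelicUnits K Eγ) : glTwoDatumTorusMap K γ u = glTwoTorusMap K γ u := rfl

variable (K γ) in
/-- The local torus map is continuous. [folklore] -/
theorem continuous_glTwoLocalTorusMap (v : HeightOneSpectrum (𝓞 K)) : Continuous (glTwoLocalTorusMap K γ v) :=
  Continuous.units_map _ (ScalarExtension.continuous_subalgebraToMatrix K (v.adicCompletion K) Eγ)

variable (K γ) in
/-- The local torus map is injective. [folklore] -/
theorem glTwoLocalTorusMap_injective (v : HeightOneSpectrum (𝓞 K)) : Function.Injective (glTwoLocalTorusMap K γ v) :=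
  Units.map_injective (ScalarExtension.subalgebraToMatrix_injective K (v.adicCompletion K) Eγ)

variable (K γ) in
/-- The keyed adelic torus map is continuous. [folklore] -/
theorem continuous_glTwoDatumTorusMap : Continuous (glTwoDatumTorusMap K γ) :=
  continuous_glTwoTorusMap K γ

variable (K γ) in
/-- The keyed adelic torus map is injective. [folklore] -/
theorem glTwoDatumTorusMap_injective : Function.Injective (glTwoDatumTorusMap K γ) :=
  glTwoTorusMap_injective K γ

/-- **`(j u)_v = j_v (u_v)`**: the torus maps commute with the projections to the components.
[cite: Gelbart1975, p. 155] -/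
theorem toLocalAt_glTwoDatumTorusMap (v : HeightOneSpectrum (𝓞 K)) (u : adelicUnits K Eγ) :
    GLn.toLocalAt 2 K v (glTwoDatumTorusMap K γ u) = glTwoLocalTorusMap K γ v (toCompletionUnits K Eγ v u) := by
  refine Matrix.GeneralLinearGroup.ext fun i j => ?_
  have h := ScalarExtension.subalgebraToMatrix_mapLeft K Eγ (adeleEvalAlgHom K v)
    ((u : adelicUnits K Eγ) : ScalarExtension K (AdeleRing (𝓞 K) K) Eγ)
  -- entry `(i, j)`: `adeleEval_v (j_𝔸 u)_{ij} = j_v ((adeleEval_v ⊗ 1) u)_{ij}`, definitionally the entries of `h`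
  exact congrFun (congrFun h i) j

/-- **`j (ι_v t) = ι_v (j_v t)`**: the torus maps commute with the local embeddings. [cite: Gelbart1975, p. 155] -/
theorem glTwoDatumTorusMap_ofLocal (v : HeightOneSpectrum (𝓞 K)) (t : completionUnits Eγ v) :
    glTwoDatumTorusMap K γ (Quat.ofLocal K Eγ v t) = GLn.toAdelic 2 K v (glTwoLocalTorusMap K γ v t) := by
  refine Matrix.GeneralLinearGroup.ext fun i j => ?_
  change ScalarExtension.subalgebraToMatrix K (AdeleRing (𝓞 K) K) Eγ
      (1 + Quat.localToAdelic K Eγ v (((t : completionUnits Eγ v) : ScalarExtension K (v.adicCompletion K) Eγ) - 1)) i j =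
    (1 : Matrix (Fin 2) (Fin 2) (AdeleRing (𝓞 K) K)) i j +
      adeleSingleHom K v (ScalarExtension.subalgebraToMatrix K (v.adicCompletion K) Eγ
        ((t : completionUnits Eγ v) : ScalarExtension K (v.adicCompletion K) Eγ) i j -
          (1 : Matrix (Fin 2) (Fin 2) (v.adicCompletion K)) i j)
  rw [map_add, map_one, ScalarExtension.subalgebraToMatrix_localToAdelic, map_sub, map_one, Matrix.add_apply,
    Matrix.map_apply, Matrix.sub_apply]

variable {S : Finset (HeightOneSpectrum (𝓞 K))}

/-- **`j (E^{S,×}) ⊆ G^S`.** [folklore] -/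
theorem glTwoDatumTorusMap_mem_trivialAt {c : adelicUnits K Eγ} (hc : c ∈ Quat.trivialAt K Eγ S) :
    glTwoDatumTorusMap K γ c ∈ GLn.trivialAt 2 K S := by
  rw [GLn.mem_trivialAt_iff]
  rw [Quat.mem_trivialAt_iff] at hc
  intro v hv
  rw [toLocalAt_glTwoDatumTorusMap, hc v hv, map_one]

/-- **`j (ι_S t) = ι_S (j_S t)`** with `j_S t = (j_v t_v)_{v ∈ S}`. [folklore] -/
theorem glTwoDatumTorusMap_toAdelicPi (t : Quat.LocalPi K Eγ S) :
    glTwoDatumTorusMap K γ (Quat.toAdelicPi K Eγ S t) =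
      GLn.toAdelicPi 2 K S (fun v => glTwoLocalTorusMap K γ (v : HeightOneSpectrum (𝓞 K)) (t v)) := by
  classical
  rw [Quat.toAdelicPi_apply, GLn.toAdelicPi_apply, Finset.map_noncommProd]
  refine Finset.noncommProd_congr rfl (fun w _ => ?_) _
  exact glTwoDatumTorusMap_ofLocal _ (t w)

/-- **`j ∘ splitting_E = splitting_{GL₂} ∘ (j_S × j|_{E^{S,×}})`**: the torus map in the coordinates
`E_𝔸ˣ = E_Sˣ × E^{S,×}`, `GL₂(𝔸_K) = G_S × G^S` (Gelbart p. 155: `B_𝔸 = B_S × B^S`).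
[cite: Gelbart1975, §10 pp. 153–155] -/
theorem glTwoDatumTorusMap_placesSplitting (p : Quat.LocalPi K Eγ S × Quat.trivialAt K Eγ S) :
    glTwoDatumTorusMap K γ (Quat.placesSplitting K Eγ S p) =
      GLn.placesSplitting 2 K S
        (fun v => glTwoLocalTorusMap K γ (v : HeightOneSpectrum (𝓞 K)) (p.1 v),
          ⟨glTwoDatumTorusMap K γ (p.2 : adelicUnits K Eγ), glTwoDatumTorusMap_mem_trivialAt p.2.2⟩) := by
  rw [Quat.placesSplitting_apply, GLn.placesSplitting_apply, map_mul, glTwoDatumTorusMap_toAdelicPi]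

/-- **The inverse splittings correspond**: `splitting_{GL₂}⁻¹ (j u) = (j_S × j) (splitting_E⁻¹ u)`.
[cite: Gelbart1975, §10 pp. 153–155] -/
theorem placesSplitting_symm_glTwoDatumTorusMap (u : adelicUnits K Eγ) :
    (GLn.placesSplitting 2 K S).symm (glTwoDatumTorusMap K γ u) =
      (fun v : S => glTwoLocalTorusMap K γ (v : HeightOneSpectrum (𝓞 K)) (((Quat.placesSplitting K Eγ S).symm u).1 v),
        ⟨glTwoDatumTorusMap K γ (((Quat.placesSplitting K Eγ S).symm u).2 : adelicUnits K Eγ),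
          glTwoDatumTorusMap_mem_trivialAt ((Quat.placesSplitting K Eγ S).symm u).2.2⟩) := by
  apply (GLn.placesSplitting 2 K S).injective
  rw [ContinuousMulEquiv.apply_symm_apply, ← glTwoDatumTorusMap_placesSplitting, ContinuousMulEquiv.apply_symm_apply]

/-- The `S`-components of `j u` are the `j_v (u_v)`. [folklore] -/
theorem placesSplitting_symm_glTwoDatumTorusMap_fst (u : adelicUnits K Eγ) (v : S) :
    ((GLn.placesSplitting 2 K S).symm (glTwoDatumTorusMap K γ u)).1 v =
      glTwoLocalTorusMap K γ (v : HeightOneSpectrum (𝓞 K)) (((Quat.placesSplitting K Eγ S).symm u).1 v) := by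
  rw [placesSplitting_symm_glTwoDatumTorusMap]

/-- **`j (s_S u) = s_S (j u)`**: the parts away from `S` correspond. [folklore] -/
theorem glTwoDatumTorusMap_awayFromPlaces (u : adelicUnits K Eγ) :
    glTwoDatumTorusMap K γ (Quat.awayFromPlaces K Eγ S u) = GLn.awayFromPlaces 2 K S (glTwoDatumTorusMap K γ u) := by
  have h := congrArg (fun p : GLn.LocalPi 2 K S × GLn.trivialAt 2 K S => ((p.2 : GLn.trivialAt 2 K S) : (AdelicGroupData.gl 2 K).Adelic))
    (placesSplitting_symm_glTwoDatumTorusMap (S := S) (γ := γ) u)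
  simp only [GLn.placesSplitting_symm_apply_snd, Quat.placesSplitting_symm_apply_snd] at h
  exact h.symm

end Torus

end Literature.NumberTheory.Automorphic
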